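import Literature.Analysis.Calculus.ExpDuhamel
import Literature.Analysis.ODE.OneSidedComparison
import Mathlib.Analysis.SpecialFunctions.Exponential

/-!
# `Balaban1983to89.B9Eq350GroupPencilWordDefect` — T. Bałaban, *Propagators for lattice gauge theories in a background field*, Commun. Math. Phys.
# **99** (1985) 389–434 [Balaban1985BackgroundPropagators] Thm 3.4 p. 400, (3.50)–(3.53) p. 400, (3.84) p. 407: **THE GROUP PENCIL'S WORD DEFECT
# AGAINST THE REAL BASE POINT IS A FUNCTION OF `|z|` — `‖∏Uᵢe^{z•Aᵢ} − ∏Uᵢ‖ ≤ (e^{|z|a})ⁿ − 1` by BINOMIAL TELESCOPING (only `‖Uᵢ‖ ≤ 1`, no unitarity of the complex background, no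
# commutativity); with the bond scale inside the exponent (print's `U′ = e^{iηA}`) THE SCALE CANCELS at first order (`η⁻¹((e^{ρηa})ⁿ − 1) ≤
# nρa(e^{ρa})ⁿ`) AND at second order (print's `F′(z) = η⁻²(e^{ηz} − 1 − ηz)` at the word level: `‖∏xᵢ − ∏yᵢ − W‖ ≤ (1 + ε)ⁿ − 1 − nε`,
# `η⁻²`·that `≤ (n²∕2)ε₀²(1 + ε₀)ⁿ`)** — abstract normed-ring ∕ Banach-algebra letters; the defect input `hDΘ` of the sibling `B9Eq386GreenGroupPencilEnergy`
# (N54), next to the analyticity input of `B9Eq350GroupPencilLettersEntire`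

statement-level skeleton of published theorems with citation tags; proofs where landed; nothing here is a claim about the Yang–Mills mass gap

CITATION HEADER (lean-in-tree rule).  Audit cell `pub-balaban`, sub-cell `t4`, BINDER row NE9; filed by NE9 formalisation-swarm LEAF PROVER 01
(`b2b-balaban-t4-ne9-formalise-leaf-01`, gen 89) under the crux-ideation seat t4-ne9-idea-1 gen 153's located note N54 («THE GROUP PENCIL IS TYPE (B)
TOO»; cell journal 2026-08-25 l.64371 ∕ l.64788; card `t4/ideate/NE9/lens1-g153/N54-GROUP-PENCIL-g153.md`), leaf-01 named first.  CREDIT: the mechanism AND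
the Lean text of §§1–4 are t4-ne9-idea-1 g153's scratch kernel `NE9GroupPencilTypeB` (ccac8e3be9f51d84, §3, §3b, §3c, §6; NOT-TO-FILE under the
cell's FREEZE (0)), ported token for token except: the kernel's recursive `def linWord` is replaced by a HYPOTHESISED word `W : List (𝔸 × 𝔸) → 𝔸` carrying
its two recursion equations as binders (proof lane: no `def`; the consumer's concrete first-order word discharges them by `rfl`, §4 inhabits `W`).
Namespace, header and docstring locators are this seat's.  Sources READ first-hand in the held text layer (`paper:balaban1985-cmp99-background-propagators`,
journal page = PDF page + 388): p. 400 Thm 3.4 (`U′U`, `U′ = e^{iηA}`, `A` *«with values in the complexified Lie algebra g^c»*); (3.50) `(Δ_{U′U}λ)(x) =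
η⁻²(2dλ(x) − Σ_{b∈st(x)} exp(iη ad_{A′(b)})R(U_b)λ(b₊))` *«Expanding the exponential above we get»* (3.51) with `F′_{1,k}(z) = η⁻²(e^{ηz} − 1 − ηz) =
z²∫₀¹dt(1 − t)e^{ηtz}` *«hence F′_{1,k}(i ad_{A′(b)}) is an analytic function of A(b)»*; (3.52) the first-order operator `V₁(A)` (coefficients `ad A′`,
`D*_U A`); (3.53) `Δ_{U′U} = Δ_U − V₁(A)`; p. 407 (3.84) `Δ_a(U′U) = Δ_a(U) − V(A)`.  Print bounds `V(A)` in SUP norm through Thm 3.3 ((3.85)); the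
telescoping here is the FORM-currency substitute of `t4/ROUTES-NE9.md` §L1.4 (N54) and asserts nothing of (3.85).

WHY THIS FILE (cell context, N54 §3, §3b, §3c).  The sibling `B9Eq386GreenGroupPencilEnergy` inverts the analytic pencil `S₀ + D(z)` given (a) `D`
analytic on a disc (`B9Eq350GroupPencilLettersEntire`) and (b) a form-defect FUNCTION `Θ(|z|)`.  At the lattice `D(z) = H_κ(U·e^{z•ηA}) − H_κ(U)`
and (b) is §1 here: an `n`-letter transport word moves by `(e^{|z|a})ⁿ − 1`, using only `‖U(b)‖ ≤ 1` at the REAL base point (coercivity is used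
there and nowhere else, so no unitarity of complex members and no (CDT) over `‖U^{±1}‖ ≤ 1 + ε` is ever needed).  §2: the letters carry the bond
scale in the exponent (print's `U′ = e^{iηA}`) and the words are read through difference quotients `η_b⁻¹(…)` (covariant derivatives) — the `η⁻¹` is
absorbed, the defect function handed to the sibling is `η`-free.  §3: the `η⁻²`-weighted (plaquette ∕ curvature) letters see `∏xᵢ − ∏yᵢ = W +
remainder` with the telescoping REMAINDER second order, and `η⁻²` is absorbed exactly by the remainder; the LINEAR word `W` carries one `η` per letter,
so `η⁻²·W = η⁻¹ × (first order in A)` is print's first-order DIFFERENTIAL coefficient (`ad A′`, `D*_U A` of (3.51)–(3.52)), paid by the REGULARITY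
letter of (3.37) — the junction's business, NOT typed here.

WHAT IS PROVED (sorry-free; proof lane — no `def`; [folklore] normed-ring telescoping + Banach-algebra `exp` letters + real analysis; imports `Literature.Analysis.Calculus.ExpDuhamel` (`norm_exp_sub_one_le`) and `Literature.Analysis.ODE.OneSidedComparison` (`exp_sub_one_le_mul_exp`)).
* §1 (`[NormedRing 𝔸] [NormOneClass 𝔸]`): `norm_list_prod_le_one`, **`norm_prod_sub_prod_le`** (`‖yᵢ‖ ≤ 1`, `‖xᵢ − yᵢ‖ ≤ ε` ⟹ `‖∏xᵢ − ∏yᵢ‖ ≤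
  (1 + ε)ⁿ − 1`; no unitarity, no commutativity); with `[NormedAlgebra ℂ 𝔸] [CompleteSpace 𝔸]`: `norm_mul_exp_smul_sub_le` (`‖U·exp(z•A) − U‖ ≤
  e^{‖z‖‖A‖} − 1` for `‖U‖ ≤ 1`; `Literature.Analysis.Calculus.norm_exp_sub_one_le` BY NAME), `norm_exp_neg_smul_mul_sub_le`,
  **`norm_transportWord_sub_le`** (`‖Uᵢ‖ ≤ 1`, `‖Aᵢ‖ ≤ a` ⟹ `‖∏Uᵢexp(z•Aᵢ) − ∏Uᵢ‖ ≤ (e^{‖z‖a})ⁿ − 1`).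
* §2 (`e^y − 1 ≤ ye^y` = the tree's `Literature.Analysis.ODE.exp_sub_one_le_mul_exp` BY NAME) **`scale_cancels`** (`0 < η`: `η⁻¹((e^{ρηa})ⁿ − 1) ≤ nρa(e^{ρηa})ⁿ`), `scale_cancels_uniform`
  (`η ≤ 1`: `≤ nρa(e^{ρa})ⁿ`).
* §3 (`W` with `W [] = 0`, `W (p :: l) = (p.1 − p.2)·∏(snd l) + p.2·W l`): `norm_linWord_le` (`‖W l‖ ≤ nε`), **`norm_prod_sub_prod_sub_linWord_le`**
  (`‖∏xᵢ − ∏yᵢ − W l‖ ≤ (1 + ε)ⁿ − 1 − nε`), `one_add_pow_sub_sub_le` (`(1 + ε)ⁿ − 1 − nε ≤ (n²∕2)ε²(1 + ε)ⁿ`), **`scale_cancels_second_order`**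
  (`0 < η ≤ 1`: `η⁻²·((1 + ηε₀)ⁿ − 1 − nηε₀) ≤ (n²∕2)ε₀²(1 + ε₀)ⁿ`), `exp_scale_sub_one_le_linear` (`e^{ρηa} − 1 ≤ η·(ρa·e^{ρa})`).
* §4 non-vacuity: `W` inhabited by a pair-valued `foldr`; the telescoping bound is sharp at one letter.
MODEL ∕ HONEST SCOPE.  (M1) abstract letters (`𝔸` = matrices, `E →L[ℂ] E`, …); no lattice object.  (M2) DISPLAYED: `a` (letter size), `n` (word
length), `η` (bond scale), `ε, ε₀`; at the junction `a` must be read as the (3.37) norm of `A` (magnitude AND lattice derivative for the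
second-order letters).  (M3) the identification of `η⁻¹·W` with print's `curl_U A` ∕ `D*_U A` coefficient and its (3.37) price are NOT typed.  (M4)
not print's (3.85) (sup norm via Thm 3.3); nothing of [B9] Thm 3.1 ∕ 3.3 ∕ 3.4 asserted, valued or discharged.  NOT NE9 (cell pub-balaban: NE9 NOT
PRINTED ∕ NOT PROVED; «NE9 ⇐ the named binders»; row WALLED ON A MODEL (O-NE9-1; #5 UNRULED); spine PROVED 0∕9; rung (B)+1 on a finite T⁴ — NOT
infinite volume, NOT mass gap, NOT BetaPertH, NOT Clay).  HONEST DEPENDENCY (cell line): continuum YM on T⁴ ⇐ BetaPertH ∧ nine spine estimates (0/9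
proved); BetaPertH ⇐ (D1) ∧ (D4) ∧ CAP+tail; G-an2-4 gates asym, D1 and NE2/3/4.  NEW file; nothing modified.  Net new unproved facts: 0.
-/

noncomputable section

open NormedSpace

namespace Literature.MathematicalPhysics.QuantumFieldTheory.Balaban1983to89.B9Eq350GroupPencilWordDefect

open Literature.Analysis.ODE (exp_sub_one_le_mul_exp)

/-! ## §1 THE WORD DEFECT OF THE GROUP PENCIL IS A FUNCTION OF `|z|`: binomial telescoping -/

section Telescoping

variable {𝔸 : Type*} [NormedRing 𝔸] [NormOneClass 𝔸]

/-- A product of elements of norm `≤ 1` has norm `≤ 1`. [folklore] [cite: Balaban1985BackgroundPropagators, (3.50) p.400] -/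
theorem norm_list_prod_le_one {l : List 𝔸} (h : ∀ y ∈ l, ‖y‖ ≤ 1) : ‖l.prod‖ ≤ 1 := by
  induction l with
  | nil => simp
  | cons y l ih =>
    rw [List.prod_cons]
    calc ‖y * l.prod‖ ≤ ‖y‖ * ‖l.prod‖ := norm_mul_le _ _
      _ ≤ 1 * 1 := mul_le_mul (h y (by simp)) (ih fun x hx => h x (by simp [hx])) (norm_nonneg _) zero_le_one
      _ = 1 := one_mul _

/-- **BINOMIAL TELESCOPING**: `‖yᵢ‖ ≤ 1`, `‖xᵢ − yᵢ‖ ≤ ε` (`ε ≥ 0`) ⟹ `‖∏xᵢ − ∏yᵢ‖ ≤ (1 + ε)ⁿ − 1` in any normed ring with `‖1‖ = 1`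
(`∏(x::xs) − ∏(y::ys) = x(∏xs − ∏ys) + (x − y)∏ys`, `‖x‖ ≤ 1 + ε`). No unitarity, no commutativity. [folklore]
[cite: Balaban1985BackgroundPropagators, (3.50)–(3.51) p.400 («Expanding the exponential above»)] -/
theorem norm_prod_sub_prod_le {ε : ℝ} (hε : 0 ≤ ε) (l : List (𝔸 × 𝔸)) (hy : ∀ p ∈ l, ‖p.2‖ ≤ 1)
    (hxy : ∀ p ∈ l, ‖p.1 - p.2‖ ≤ ε) :
    ‖(l.map Prod.fst).prod - (l.map Prod.snd).prod‖ ≤ (1 + ε) ^ l.length - 1 := by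
  induction l with
  | nil => simp
  | cons p l ih =>
    simp only [List.map_cons, List.prod_cons, List.length_cons]
    set P := (l.map Prod.fst).prod
    set Q := (l.map Prod.snd).prod
    have hQ : ‖Q‖ ≤ 1 := norm_list_prod_le_one fun y hy' => by
      obtain ⟨q, hq, rfl⟩ := List.mem_map.mp hy'
      exact hy q (by simp [hq])
    have hPQ : ‖P - Q‖ ≤ (1 + ε) ^ l.length - 1 :=
      ih (fun q hq => hy q (by simp [hq])) (fun q hq => hxy q (by simp [hq]))
    have hx : ‖p.1‖ ≤ 1 + ε := by
      have h1 : ‖p.1‖ ≤ ‖p.1 - p.2‖ + ‖p.2‖ := by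
        calc ‖p.1‖ = ‖(p.1 - p.2) + p.2‖ := by rw [sub_add_cancel]
          _ ≤ ‖p.1 - p.2‖ + ‖p.2‖ := norm_add_le _ _
      linarith [hxy p (by simp), hy p (by simp)]
    have hid : p.1 * P - p.2 * Q = p.1 * (P - Q) + (p.1 - p.2) * Q := by noncomm_ring
    have hpow : 0 ≤ (1 + ε) ^ l.length - 1 := sub_nonneg.mpr (one_le_pow₀ (by linarith))
    rw [hid]
    calc ‖p.1 * (P - Q) + (p.1 - p.2) * Q‖ ≤ ‖p.1‖ * ‖P - Q‖ + ‖p.1 - p.2‖ * ‖Q‖ :=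
          (norm_add_le _ _).trans (add_le_add (norm_mul_le _ _) (norm_mul_le _ _))
      _ ≤ (1 + ε) * ((1 + ε) ^ l.length - 1) + ε * 1 :=
          add_le_add (mul_le_mul hx hPQ (norm_nonneg _) (by linarith))
            (mul_le_mul (hxy p (by simp)) hQ (norm_nonneg _) hε)
      _ = (1 + ε) ^ (l.length + 1) - 1 := by ring

variable [NormedAlgebra ℂ 𝔸] [CompleteSpace 𝔸]

omit [NormOneClass 𝔸] in
/-- **ONE BOND LETTER MOVES BY `e^{|z|‖A‖} − 1`**: `‖U·exp(z•A) − U‖ ≤ e^{‖z‖‖A‖} − 1` for `‖U‖ ≤ 1` (`Literature.Analysis.Calculus.norm_exp_sub_one_le`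
BY NAME; only `‖U‖ ≤ 1` at the REAL base point is used). [folklore] [cite: Balaban1985BackgroundPropagators, (3.50)–(3.51) p.400] -/
theorem norm_mul_exp_smul_sub_le {U A : 𝔸} (hU : ‖U‖ ≤ 1) (z : ℂ) :
    ‖U * exp (z • A) - U‖ ≤ Real.exp (‖z‖ * ‖A‖) - 1 := by
  have h1 : U * exp (z • A) - U = U * (exp (z • A) - 1) := by rw [mul_sub, mul_one]
  have h2 : ‖exp (z • A) - 1‖ ≤ Real.exp ‖z • A‖ - 1 := Literature.Analysis.Calculus.norm_exp_sub_one_le _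
  have h3 : Real.exp ‖z • A‖ ≤ Real.exp (‖z‖ * ‖A‖) := Real.exp_le_exp.mpr (norm_smul_le z A)
  rw [h1]
  calc ‖U * (exp (z • A) - 1)‖ ≤ ‖U‖ * ‖exp (z • A) - 1‖ := norm_mul_le _ _
    _ ≤ 1 * (Real.exp (‖z‖ * ‖A‖) - 1) := mul_le_mul hU (h2.trans (by linarith)) (norm_nonneg _) zero_le_one
    _ = Real.exp (‖z‖ * ‖A‖) - 1 := one_mul _

omit [NormOneClass 𝔸] in
/-- The continued inverse letter moves by the same amount: `‖exp(−z•A)·V − V‖ ≤ e^{‖z‖‖A‖} − 1` for `‖V‖ ≤ 1`. [folklore]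
[cite: Balaban1985BackgroundPropagators, (3.50)–(3.51) p.400] -/
theorem norm_exp_neg_smul_mul_sub_le {V A : 𝔸} (hV : ‖V‖ ≤ 1) (z : ℂ) :
    ‖exp (-(z • A)) * V - V‖ ≤ Real.exp (‖z‖ * ‖A‖) - 1 := by
  have h1 : exp (-(z • A)) * V - V = (exp (-(z • A)) - 1) * V := by rw [sub_mul, one_mul]
  have h2 : ‖exp (-(z • A)) - 1‖ ≤ Real.exp ‖-(z • A)‖ - 1 := Literature.Analysis.Calculus.norm_exp_sub_one_le _
  have h3 : Real.exp ‖-(z • A)‖ ≤ Real.exp (‖z‖ * ‖A‖) := by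
    rw [norm_neg]; exact Real.exp_le_exp.mpr (norm_smul_le z A)
  rw [h1]
  calc ‖(exp (-(z • A)) - 1) * V‖ ≤ ‖exp (-(z • A)) - 1‖ * ‖V‖ := norm_mul_le _ _
    _ ≤ (Real.exp (‖z‖ * ‖A‖) - 1) * 1 := mul_le_mul (h2.trans (by linarith)) hV (norm_nonneg _) (by
        linarith [Real.add_one_le_exp (‖z‖ * ‖A‖), mul_nonneg (norm_nonneg z) (norm_nonneg A)])
    _ = Real.exp (‖z‖ * ‖A‖) - 1 := mul_one _

/-- **AN `n`-LETTER TRANSPORT WORD MOVES BY `(e^{|z|a})ⁿ − 1`**: bonds `(Uᵢ, Aᵢ)` with `‖Uᵢ‖ ≤ 1`, `‖Aᵢ‖ ≤ a` ⟹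
`‖∏ Uᵢexp(z•Aᵢ) − ∏ Uᵢ‖ ≤ (e^{‖z‖a})ⁿ − 1` — the group pencil's word defect is a FUNCTION of `|z|`, with no unitarity of the complex background
(coercivity is used at the real base point only). [folklore]
[cite: Balaban1985BackgroundPropagators, (3.50)–(3.53) p.400 (expansion of `e^{iη ad A}`), (3.84) p.407] -/
theorem norm_transportWord_sub_le {a : ℝ} (ha : 0 ≤ a) (l : List (𝔸 × 𝔸)) (hU : ∀ p ∈ l, ‖p.1‖ ≤ 1)
    (hA : ∀ p ∈ l, ‖p.2‖ ≤ a) (z : ℂ) :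
    ‖(l.map fun p => p.1 * exp (z • p.2)).prod - (l.map Prod.fst).prod‖ ≤ Real.exp (‖z‖ * a) ^ l.length - 1 := by
  have hε : 0 ≤ Real.exp (‖z‖ * a) - 1 := by
    linarith [Real.add_one_le_exp (‖z‖ * a), mul_nonneg (norm_nonneg z) ha]
  have key := norm_prod_sub_prod_le hε (l.map fun p => (p.1 * exp (z • p.2), p.1)) ?_ ?_
  · have h1 : (1 + (Real.exp (‖z‖ * a) - 1)) = Real.exp (‖z‖ * a) := by ring
    rw [h1, List.length_map, List.map_map, List.map_map] at key
    exact key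
  · intro q hq
    obtain ⟨p, hp, rfl⟩ := List.mem_map.mp hq
    exact hU p hp
  · intro q hq
    obtain ⟨p, hp, rfl⟩ := List.mem_map.mp hq
    calc ‖p.1 * exp (z • p.2) - p.1‖ ≤ Real.exp (‖z‖ * ‖p.2‖) - 1 := norm_mul_exp_smul_sub_le (hU p hp) z
      _ ≤ Real.exp (‖z‖ * a) - 1 := by
          have : ‖z‖ * ‖p.2‖ ≤ ‖z‖ * a := mul_le_mul_of_nonneg_left (hA p hp) (norm_nonneg z)
          linarith [Real.exp_le_exp.mpr this]

end Telescoping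

/-! ## §2 THE SCALE CANCELS: the difference-quotient prefactor `η⁻¹` is absorbed by the `η` inside the exponent -/

section ScaleCancels

/-- **THE SCALE CANCELS**: a transport word of `n` letters `U(b)·exp(z•ηA(b))` (the lattice pencil carries the bond scale `η` in the exponent, as
print's `U′ = e^{iηA}`), read through a difference quotient `η⁻¹(…)`, moves by `η⁻¹((e^{ρηa})ⁿ − 1) ≤ n·ρ·a·(e^{ρηa})ⁿ` — NO `η⁻¹` survives.
[folklore] [cite: Balaban1985BackgroundPropagators, (3.50)–(3.52) p.400 (`F′_{1,k}(z) = η⁻²(e^{ηz} − 1 − ηz)`, first-order coefficients `ad A′`, `D*A`)] -/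
theorem scale_cancels {η ρ a : ℝ} (hη : 0 < η) (n : ℕ) :
    η⁻¹ * (Real.exp (ρ * (η * a)) ^ n - 1) ≤ n * ρ * a * Real.exp (ρ * (η * a)) ^ n := by
  rw [← Real.exp_nat_mul]
  set y := (n : ℝ) * (ρ * (η * a)) with hy
  have h1 := exp_sub_one_le_mul_exp y
  have h2 : η⁻¹ * y = n * ρ * a := by
    have h3 : η⁻¹ * y = n * ρ * a * (η⁻¹ * η) := by rw [hy]; ring
    rw [h3, inv_mul_cancel₀ hη.ne', mul_one]
  calc η⁻¹ * (Real.exp y - 1) ≤ η⁻¹ * (y * Real.exp y) := mul_le_mul_of_nonneg_left h1 (inv_nonneg.mpr hη.le)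
    _ = (η⁻¹ * y) * Real.exp y := by ring
    _ = n * ρ * a * Real.exp y := by rw [h2]

/-- **UNIFORM IN `η ≤ 1`**: `η⁻¹((e^{ρηa})ⁿ − 1) ≤ n·ρ·a·(e^{ρa})ⁿ` — the defect FUNCTION the lattice junction feeds to the sibling's pencil is
`η`-free. [folklore] [cite: Balaban1985BackgroundPropagators, (3.50)–(3.52) p.400] -/
theorem scale_cancels_uniform {η ρ a : ℝ} (hη : 0 < η) (hη1 : η ≤ 1) (hρ : 0 ≤ ρ) (ha : 0 ≤ a) (n : ℕ) :
    η⁻¹ * (Real.exp (ρ * (η * a)) ^ n - 1) ≤ n * ρ * a * Real.exp (ρ * a) ^ n := by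
  have h1 := scale_cancels hη n (ρ := ρ) (a := a)
  have h2 : Real.exp (ρ * (η * a)) ≤ Real.exp (ρ * a) := by
    apply Real.exp_le_exp.mpr
    have : η * a ≤ a := by nlinarith
    exact mul_le_mul_of_nonneg_left this hρ
  have h3 : Real.exp (ρ * (η * a)) ^ n ≤ Real.exp (ρ * a) ^ n := pow_le_pow_left₀ (Real.exp_pos _).le h2 n
  have h4 : 0 ≤ (n : ℝ) * ρ * a := by positivity
  exact h1.trans (mul_le_mul_of_nonneg_left h3 h4)

end ScaleCancels

/-! ## §3 THE SECOND-ORDER (PLAQUETTE ∕ CURVATURE) STEP: print's `F′(z) = η⁻²(e^{ηz} − 1 − ηz)` at the word level.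
The LINEAR (one-defect) word `W l = Σᵢ y₁⋯yᵢ₋₁(xᵢ − yᵢ)yᵢ₊₁⋯yₙ` enters through its two recursion equations as binders (no `def` in this lane). -/

section SecondOrder

variable {𝔸 : Type*} [NormedRing 𝔸] [NormOneClass 𝔸]
  (W : List (𝔸 × 𝔸) → 𝔸) (hW0 : W [] = 0)
  (hWc : ∀ (p : 𝔸 × 𝔸) (l : List (𝔸 × 𝔸)), W (p :: l) = (p.1 - p.2) * (l.map Prod.snd).prod + p.2 * W l)

include hW0 hWc in
/-- `‖W l‖ ≤ n·ε` for `‖yᵢ‖ ≤ 1`, `‖xᵢ − yᵢ‖ ≤ ε` — the linear word is first order. [folklore]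
[cite: Balaban1985BackgroundPropagators, (3.51)–(3.52) p.400 (the first-order operator `V₁(A)`)] -/
theorem norm_linWord_le {ε : ℝ} (hε : 0 ≤ ε) (l : List (𝔸 × 𝔸)) (hy : ∀ p ∈ l, ‖p.2‖ ≤ 1)
    (hxy : ∀ p ∈ l, ‖p.1 - p.2‖ ≤ ε) : ‖W l‖ ≤ l.length * ε := by
  induction l with
  | nil => simp [hW0]
  | cons p l ih =>
    rw [hWc, List.length_cons]
    have hQ : ‖(l.map Prod.snd).prod‖ ≤ 1 := norm_list_prod_le_one fun y hy' => by
      obtain ⟨q, hq, rfl⟩ := List.mem_map.mp hy'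
      exact hy q (by simp [hq])
    have ih' := ih (fun q hq => hy q (by simp [hq])) (fun q hq => hxy q (by simp [hq]))
    have hl : 0 ≤ (l.length : ℝ) * ε := by positivity
    calc ‖(p.1 - p.2) * (l.map Prod.snd).prod + p.2 * W l‖
        ≤ ‖p.1 - p.2‖ * ‖(l.map Prod.snd).prod‖ + ‖p.2‖ * ‖W l‖ :=
          (norm_add_le _ _).trans (add_le_add (norm_mul_le _ _) (norm_mul_le _ _))
      _ ≤ ε * 1 + 1 * (l.length * ε) :=
          add_le_add (mul_le_mul (hxy p (by simp)) hQ (norm_nonneg _) hε)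
            (mul_le_mul (hy p (by simp)) ih' (norm_nonneg _) zero_le_one)
      _ = (↑(l.length + 1) : ℝ) * ε := by push_cast; ring

include hW0 hWc in
/-- **SECOND-ORDER TELESCOPING**: `‖∏xᵢ − ∏yᵢ − W‖ ≤ (1 + ε)ⁿ − 1 − nε` for `‖yᵢ‖ ≤ 1`, `‖xᵢ − yᵢ‖ ≤ ε`
(`∏(x::xs) − ∏(y::ys) − W = x·(∏xs − ∏ys − W′) + (x − y)·W′`; the recursion closes EXACTLY on `D_{n+1} = (1 + ε)D_n + nε²`). No unitarity, no
commutativity. [folklore] [cite: Balaban1985BackgroundPropagators, (3.51)–(3.52) p.400 (`F′_{1,k}(z) = η⁻²(e^{ηz} − 1 − ηz) = z²∫₀¹dt(1 − t)e^{ηtz}`)] -/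
theorem norm_prod_sub_prod_sub_linWord_le {ε : ℝ} (hε : 0 ≤ ε) (l : List (𝔸 × 𝔸)) (hy : ∀ p ∈ l, ‖p.2‖ ≤ 1)
    (hxy : ∀ p ∈ l, ‖p.1 - p.2‖ ≤ ε) :
    ‖(l.map Prod.fst).prod - (l.map Prod.snd).prod - W l‖ ≤ (1 + ε) ^ l.length - 1 - l.length * ε := by
  induction l with
  | nil => simp [hW0]
  | cons p l ih =>
    simp only [List.map_cons, List.prod_cons, List.length_cons, hWc]
    set P := (l.map Prod.fst).prod
    set Q := (l.map Prod.snd).prod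
    have ihl := ih (fun q hq => hy q (by simp [hq])) (fun q hq => hxy q (by simp [hq]))
    have hlin : ‖W l‖ ≤ l.length * ε :=
      norm_linWord_le W hW0 hWc hε l (fun q hq => hy q (by simp [hq])) (fun q hq => hxy q (by simp [hq]))
    have hx : ‖p.1‖ ≤ 1 + ε := by
      have h1 : ‖p.1‖ ≤ ‖p.1 - p.2‖ + ‖p.2‖ := by
        calc ‖p.1‖ = ‖(p.1 - p.2) + p.2‖ := by rw [sub_add_cancel]
          _ ≤ ‖p.1 - p.2‖ + ‖p.2‖ := norm_add_le _ _
      linarith [hxy p (by simp), hy p (by simp)]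
    have hid : p.1 * P - p.2 * Q - ((p.1 - p.2) * Q + p.2 * W l)
        = p.1 * (P - Q - W l) + (p.1 - p.2) * W l := by noncomm_ring
    have hD : 0 ≤ (1 + ε) ^ l.length - 1 - l.length * ε := by
      have := one_add_mul_le_pow (show (-2 : ℝ) ≤ ε by linarith) l.length
      linarith
    rw [hid]
    calc ‖p.1 * (P - Q - W l) + (p.1 - p.2) * W l‖
        ≤ ‖p.1‖ * ‖P - Q - W l‖ + ‖p.1 - p.2‖ * ‖W l‖ :=
          (norm_add_le _ _).trans (add_le_add (norm_mul_le _ _) (norm_mul_le _ _))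
      _ ≤ (1 + ε) * ((1 + ε) ^ l.length - 1 - l.length * ε) + ε * (l.length * ε) :=
          add_le_add (mul_le_mul hx ihl (norm_nonneg _) (by linarith))
            (mul_le_mul (hxy p (by simp)) hlin (norm_nonneg _) hε)
      _ = (1 + ε) ^ (l.length + 1) - 1 - (↑(l.length + 1) : ℝ) * ε := by push_cast; ring

/-- The discrete second-order remainder: `(1 + ε)ⁿ − 1 − nε ≤ (n²∕2)·ε²·(1 + ε)ⁿ` (`ε ≥ 0`; induction on `D_{n+1} = (1 + ε)D_n + nε²`).
[folklore] [cite: Balaban1985BackgroundPropagators, (3.51) p.400] -/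
theorem one_add_pow_sub_sub_le {ε : ℝ} (hε : 0 ≤ ε) (n : ℕ) :
    (1 + ε) ^ n - 1 - n * ε ≤ (n : ℝ) ^ 2 / 2 * ε ^ 2 * (1 + ε) ^ n := by
  induction n with
  | zero => simp
  | succ n ih =>
    have h1 : (1 : ℝ) ≤ (1 + ε) ^ (n + 1) := one_le_pow₀ (by linarith)
    have hpow : 0 ≤ (1 + ε) ^ n := pow_nonneg (by linarith) n
    have key : (1 + ε) ^ (n + 1) - 1 - (↑(n + 1) : ℝ) * ε
        = (1 + ε) * ((1 + ε) ^ n - 1 - n * ε) + n * ε ^ 2 := by push_cast; ring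
    rw [key]
    have h2 : (1 + ε) * ((1 + ε) ^ n - 1 - n * ε) ≤ (1 + ε) * ((n : ℝ) ^ 2 / 2 * ε ^ 2 * (1 + ε) ^ n) :=
      mul_le_mul_of_nonneg_left ih (by linarith)
    have h3 : (n : ℝ) * ε ^ 2 ≤ (n : ℝ) * ε ^ 2 * (1 + ε) ^ (n + 1) := by
      have : 0 ≤ (n : ℝ) * ε ^ 2 := by positivity
      nlinarith
    calc (1 + ε) * ((1 + ε) ^ n - 1 - n * ε) + n * ε ^ 2
        ≤ (1 + ε) * ((n : ℝ) ^ 2 / 2 * ε ^ 2 * (1 + ε) ^ n) + (n : ℝ) * ε ^ 2 * (1 + ε) ^ (n + 1) := add_le_add h2 h3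
      _ = ((n : ℝ) ^ 2 / 2 + n) * ε ^ 2 * (1 + ε) ^ (n + 1) := by ring
      _ ≤ (↑(n + 1) : ℝ) ^ 2 / 2 * ε ^ 2 * (1 + ε) ^ (n + 1) := by
          push_cast
          have h4 : (n : ℝ) ^ 2 / 2 + n ≤ ((n : ℝ) + 1) ^ 2 / 2 := by nlinarith
          have h5 : 0 ≤ ε ^ 2 * (1 + ε) ^ (n + 1) := by positivity
          nlinarith

/-- **THE SCALE CANCELS AT SECOND ORDER**: with the one-letter defect LINEAR in the bond scale, `ε = η·ε₀`, the `η⁻²` of print's `F′` is absorbed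
exactly: `η⁻²·((1 + ηε₀)ⁿ − 1 − nηε₀) ≤ (n²∕2)ε₀²(1 + ηε₀)ⁿ ≤ (n²∕2)ε₀²(1 + ε₀)ⁿ` for `0 < η ≤ 1`, `ε₀ ≥ 0`. [folklore]
[cite: Balaban1985BackgroundPropagators, (3.51)–(3.52) p.400 (`F′_{1,k}(z) = η⁻²(e^{ηz} − 1 − ηz)` «an analytic function of A(b)»)] -/
theorem scale_cancels_second_order {η ε₀ : ℝ} (hη : 0 < η) (hη1 : η ≤ 1) (hε₀ : 0 ≤ ε₀) (n : ℕ) :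
    (η ^ 2)⁻¹ * ((1 + η * ε₀) ^ n - 1 - n * (η * ε₀)) ≤ (n : ℝ) ^ 2 / 2 * ε₀ ^ 2 * (1 + ε₀) ^ n := by
  have hε : 0 ≤ η * ε₀ := by positivity
  have h1 := one_add_pow_sub_sub_le hε n
  have hη2 : 0 < η ^ 2 := by positivity
  have h2 : (η ^ 2)⁻¹ * ((1 + η * ε₀) ^ n - 1 - n * (η * ε₀))
      ≤ (η ^ 2)⁻¹ * ((n : ℝ) ^ 2 / 2 * (η * ε₀) ^ 2 * (1 + η * ε₀) ^ n) :=
    mul_le_mul_of_nonneg_left h1 (inv_nonneg.mpr hη2.le)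
  have h3 : (η ^ 2)⁻¹ * ((n : ℝ) ^ 2 / 2 * (η * ε₀) ^ 2 * (1 + η * ε₀) ^ n) = (n : ℝ) ^ 2 / 2 * ε₀ ^ 2 * (1 + η * ε₀) ^ n := by
    field_simp
  have h4 : (1 + η * ε₀) ^ n ≤ (1 + ε₀) ^ n := by
    apply pow_le_pow_left₀ (by linarith)
    nlinarith
  have h5 : 0 ≤ (n : ℝ) ^ 2 / 2 * ε₀ ^ 2 := by positivity
  calc (η ^ 2)⁻¹ * ((1 + η * ε₀) ^ n - 1 - n * (η * ε₀))
      ≤ (η ^ 2)⁻¹ * ((n : ℝ) ^ 2 / 2 * (η * ε₀) ^ 2 * (1 + η * ε₀) ^ n) := h2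
    _ = (n : ℝ) ^ 2 / 2 * ε₀ ^ 2 * (1 + η * ε₀) ^ n := h3
    _ ≤ (n : ℝ) ^ 2 / 2 * ε₀ ^ 2 * (1 + ε₀) ^ n := mul_le_mul_of_nonneg_left h4 h5

/-- The one-letter defect of the group pencil IS linear in the bond scale: `e^{ρηa} − 1 ≤ η·(ρa·e^{ρa})` for `0 ≤ η ≤ 1`, `ρ, a ≥ 0` (so
`ε₀ := ρa·e^{ρa}` in `scale_cancels_second_order`). [folklore] [cite: Balaban1985BackgroundPropagators, (3.51) p.400] -/
theorem exp_scale_sub_one_le_linear {η ρ a : ℝ} (hη : 0 ≤ η) (hη1 : η ≤ 1) (hρ : 0 ≤ ρ) (ha : 0 ≤ a) :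
    Real.exp (ρ * (η * a)) - 1 ≤ η * (ρ * a * Real.exp (ρ * a)) := by
  have h1 := exp_sub_one_le_mul_exp (ρ * (η * a))
  have h2 : Real.exp (ρ * (η * a)) ≤ Real.exp (ρ * a) := by
    apply Real.exp_le_exp.mpr
    have : η * a ≤ a := by nlinarith
    exact mul_le_mul_of_nonneg_left this hρ
  have h3 : 0 ≤ ρ * (η * a) := by positivity
  calc Real.exp (ρ * (η * a)) - 1 ≤ ρ * (η * a) * Real.exp (ρ * (η * a)) := h1
    _ ≤ ρ * (η * a) * Real.exp (ρ * a) := mul_le_mul_of_nonneg_left h2 h3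
    _ = η * (ρ * a * Real.exp (ρ * a)) := by ring

end SecondOrder

/-! ## §4 Non-vacuity -/

section NonVacuity

/-- The linear word `W` of §3 is inhabited: the first component of the pair-valued fold `(W l, ∏(snd l))`. [folklore]
[cite: Balaban1985BackgroundPropagators, (3.52) p.400] -/
example {𝔸 : Type*} [NormedRing 𝔸] :
    ∃ W : List (𝔸 × 𝔸) → 𝔸, W [] = 0 ∧
      ∀ (p : 𝔸 × 𝔸) (l : List (𝔸 × 𝔸)), W (p :: l) = (p.1 - p.2) * (l.map Prod.snd).prod + p.2 * W l := by
  refine ⟨fun l => (l.foldr (fun p wq => ((p.1 - p.2) * wq.2 + p.2 * wq.1, p.2 * wq.2)) ((0 : 𝔸), (1 : 𝔸))).1,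
    rfl, fun p l => ?_⟩
  have hq : ∀ l : List (𝔸 × 𝔸),
      (l.foldr (fun p wq => ((p.1 - p.2) * wq.2 + p.2 * wq.1, p.2 * wq.2)) ((0 : 𝔸), (1 : 𝔸))).2 = (l.map Prod.snd).prod := by
    intro l
    induction l with
    | nil => rfl
    | cons q l ih => simp only [List.foldr_cons, List.map_cons, List.prod_cons, ih]
  simp only [List.foldr_cons, hq]

/-- The telescoping bound of §1 is sharp at one letter: `‖x − y‖ ≤ ε = (1 + ε)¹ − 1`. [folklore] [cite: Balaban1985BackgroundPropagators, (3.51) p.400] -/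
example {𝔸 : Type*} [NormedRing 𝔸] [NormOneClass 𝔸] (x y : 𝔸) {ε : ℝ} (hε : 0 ≤ ε) (hy : ‖y‖ ≤ 1) (h : ‖x - y‖ ≤ ε) :
    ‖([(x, y)].map Prod.fst).prod - ([(x, y)].map Prod.snd).prod‖ ≤ (1 + ε) ^ 1 - 1 :=
  norm_prod_sub_prod_le hε [(x, y)] (by simpa using hy) (by simpa using h)

end NonVacuity

end Literature.MathematicalPhysics.QuantumFieldTheory.Balaban1983to89.B9Eq350GroupPencilWordDefect

end
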